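import Summits.MatrixMultiplication.MatrixMultiplication.Theses.ThinBlockAlpha

/-!
# MatrixMultiplication / ThinBlockAlpha — `BoundedToThin` (stmt-MatrixMultiplication-14849)

Route `ThinBlockAlpha`, support glue `BoundedToThin : BoundedThinPackings → ThinPackings`
("forget the exponent bound"): the typed bet `BoundedThinPackings` asks, for every shape exponent
`a ∈ [0,1)`, for ONE exponent bound `ℓ = ℓ(a)` such that for every slack `η > 0` some finite abelian
group `H` of exponent `≤ ℓ` carries a thin STPP family `⟨N, M, N⟩`, `N ≥ 2`, `M ≥ N^a`,
`|H| ≤ L·N^{2+η}`; `ThinPackings` asks for the same witnesses with no condition on the exponent.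
So the implication is pure logic: fix `a, η`, take the `ℓ`-witness and drop the conjunct
`AddMonoid.exponent H ≤ ℓ`.
-/

-- the tree's namespace `Summit.MatrixMultiplication.MatrixMultiplication.…` repeats a component by design
set_option linter.dupNamespace false

namespace Summit.MatrixMultiplication.MatrixMultiplication.Theorems

open Summit.MatrixMultiplication.MatrixMultiplication.Theses.ThinBlockAlpha

/-- **Glue `BoundedToThin`** (route ThinBlockAlpha, stmt-MatrixMultiplication-14849):
`BoundedThinPackings → ThinPackings` — a bounded-exponent thin STPP family is in particular a thin
STPP family; forget the exponent bound `AddMonoid.exponent H ≤ ℓ`. -/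
theorem boundedToThin_proof :
    Summit.MatrixMultiplication.MatrixMultiplication.Theses.ThinBlockAlpha.BoundedToThin := by
  unfold BoundedToThin BoundedThinPackings ThinPackings
  intro hB a ha0 ha1 η hη
  obtain ⟨ℓ, hℓ⟩ := hB a ha0 ha1
  obtain ⟨H, instG, instF, L, N, M, A, B, C, _hexp, hS, hcard, hN, hM, hP⟩ := hℓ η hη
  exact ⟨H, instG, instF, L, N, M, A, B, C, hS, hcard, hN, hM, hP⟩

end Summit.MatrixMultiplication.MatrixMultiplication.Theorems
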